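import Literature.AlgebraicGeometry.GroupSchemes.ReductionKernelKilledByNSquare
import Literature.AlgebraicGeometry.GroupSchemes.GroupSchemeBaseChangeSquarePoints
import Literature.AlgebraicGeometry.GroupSchemes.BarsottiTateGroupBaseChange
import HarnessLib

/-!
# The kernel of a first-order lift of `N · i′` (`i′` a monomorphism of group schemes) is killed by `N · K`
# — Messing-free «stabilisation» step of the Serre–Tate lifting ([Katz1981SerreTate] §1.1 Lemmas 1.1.2–1.1.3, §1.2 proof of Thm. 1.2.1)

Layer `Literature/AlgebraicGeometry/GroupSchemes`, namespace `Literature.AlgebraicGeometry.GroupSchemes.ReductionKernel`.  THEOREMS ONLY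
(no definition, no named fact, no instance, no notation, no `sorry`).  Cell `hodgecm-mathlib` (D-0151 ∕ D-0183 FLOOR 0), P6 «MOD programme»,
Row 4B, sub-desk P6b (desk F0P6b-plan (g12)): generic, count-neutral capital `--supports stmt-HodgeConjecture-24832`, consumed by the σ2 sub-line
`Cruxes/HLiu418/Lines/F0_P6b_SerreTateSigma2.lean` — it is the STABILISATION step quoted in the docstrings of its stubs E2a
`stub_L4B1esK_kernelFiniteFlat` («`Ker (β n) ⊂ B[p²]` for all `n`») and E3 `stub_L4B1esT_torsionTowerOfQuotient` («its KERNEL IS TRIVIAL by the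
STABILISATION lemma»), now a theorem BY NAME.  HC_CM is proved only modulo the printed citations until rung 0 closes; nothing here is about HC.

THE PRINT.  [Katz1981SerreTate] §1.1: over a ring in which `N` is nilpotent … Lemma 1.1.2 «the kernel of reduction modulo a square-zero ideal
killed by `N` is killed by `N`» (Drinfeld; ★ `ReductionKernel.pow_eq_one_of_isPullback`, the base-change-square form); Lemma 1.1.3 (3): a
homomorphism `f₀` modulo the ideal has the canonical lift «`N·f`» of `N · f₀`; §1.2, proof of Thm. 1.2.1 (p. 142): the lift is built through
an isogeny whose kernel must be controlled.  THIS FILE isolates the purely group-theoretic control, with NO formal-smoothness input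
([Messing1972] II (3.3.13) is NOT used): let `c : M′ → M` and `G : X′ → X` be base-change squares of group schemes over the thickening
`Spec (A⧸J) ↪ Spec A` (`A` local, `J² = 0`, `K · J = 0`), `i′ : M′ → X′` a homomorphism with trivial kernel on points, and `β : M → X` ANY
morphism over `Spec A` lifting `N · i′` (`c ≫ β = (i′)^N ≫ G` on underlying schemes).  Then every `T`-point `u` of `M` killed by `β`
satisfies `u^(N·K) = 1`:  reduce `u` to the `T₀ = T ×_A (A⧸J)`-point `u₀` of `M′` (cartesian `c`); `β u = 1` pushes down to `(i′)^N (u₀) = 1`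
(lifting through the cartesian `G` is injective, ★ `eq_of_left_comp_eq_of_isPullback`), i.e. `i′ (u₀^N) = 1`, so `u₀^N = 1`; hence `u^N`
is the unit on `T₀` (pushing points along `c` is compatible with powers and units, ★ `pow_left_comp_eq_of_sq`), and Drinfeld's lemma (★
`pow_eq_one_of_isPullback`) kills it by `K`.  In the Serre–Tate setting (`M′ = B₀[pⁿ]`, `M = B[pⁿ]`, `X′ = X₀`, `X = Y`, `i′ = i₀ n`,
`N = K = p ∈ 𝔪_A`, `𝔪_A · J = 0`): `Ker (β n)` is killed by `p²`, uniformly in `n` — the Messing-free half of E2a.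

* §1 `pow_mul_eq_one_of_comp_eq_one_of_lift_pow` — the general statement (`J² = 0`, `K · J = 0`, exponents `N`, `K`).
* §2 `pow_sq_eq_one_of_comp_eq_one_of_lift_pow` — the Artinian-local Serre–Tate form: `J ≠ ⊤`, `𝔪_A · J = 0`, `(p : A)` nilpotent, `N = K = p`:
  `u ≫ β = 1 → u ^ (p ^ 2) = 1`.
* §3 `eq_one_of_comp_eq_one_of_isPullback_unit` — a kernel embedding `i : K ↪ X` (cartesian against `[p^n]` and the unit section, the currency
  of ★ `BTGroup.IsOfAbelianScheme`) has trivial kernel on points; `BTGroup.pow_sq_eq_one_of_comp_betaLift_eq_one` — §2 in the currency of the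
  σ2 sub-line: `B₀ → B` a base change of Barsotti–Tate groups (★ `BTGroup.IsBaseChangeVia`), `GY : X₀ → Y` a base change of abelian schemes (★
  `AbelianSchemeOver.IsBaseChangeVia`), `i₀ n : B₀[pⁿ] ↪ X₀` kernel embeddings, `β n : B[pⁿ] → Y` with `c n ≫ β n = (i₀ n)^p ≫ GY`:
  every point `u` of `B[pⁿ]` with `u ≫ β n = 1` satisfies `u ^ (p²) = 1`, for every `n`.

## References
* [Katz1981SerreTate] N. M. Katz, *Serre–Tate local moduli*, LNM 868 (1981), exp. Vbis, §1.1 Lemmas 1.1.2–1.1.3 (pp. 138–140), §1.2 proof of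
  Thm. 1.2.1 (pp. 141–142).
* [Messing1972] W. Messing, *The Crystals Associated to Barsotti–Tate Groups*, LNM 264 (1972), Ch. I (1.1)–(1.6) (base change of the layers).
* [Tate1967] J. Tate, *p-divisible groups*, Proc. Conf. Local Fields (Driebergen 1966), Springer 1967, §2 (2.1), (2.4).
-/

noncomputable section

-- Mathlib's `Over`/pull-back API is stated across semireducible wrappers (as in the ★ `GroupSchemes/*` files).
set_option backward.isDefEq.respectTransparency false

universe u

open CategoryTheory CategoryTheory.Limits AlgebraicGeometry MonoidalCategory CartesianMonoidalCategory IsLocalRing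
open scoped MonObj

namespace Literature.AlgebraicGeometry.GroupSchemes.ReductionKernel

variable {A : Type u} [CommRing A] [IsLocalRing A] {J : Ideal A}
  {M : Over (Spec (CommRingCat.of A))} [GrpObj M] {M' : Over (Spec (CommRingCat.of (A ⧸ J)))} [GrpObj M']
  {c : M'.left ⟶ M.left}
  {X : Over (Spec (CommRingCat.of A))} [GrpObj X] {X' : Over (Spec (CommRingCat.of (A ⧸ J)))} [GrpObj X']
  {G : X'.left ⟶ X.left}

/-! ## §1 The kernel of a lift of `N · i′` is killed by `N · K` -/

/-- **The kernel of a first-order lift of `N · i′` is killed by `N · K`** (Messing-free stabilisation; [Katz1981SerreTate] §1.1 Lemmas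
1.1.2–1.1.3 and §1.2, proof of Thm. 1.2.1).  `A` local, `J ⊆ A` with `J² = 0` and `K · J = 0`; `c : M′ → M`, `G : X′ → X` base-change squares
of group schemes over `Spec (A⧸J) ↪ Spec A` (cartesian, compatible with units and — for `c` — with the group laws: the clauses of ★
`BTGroup.IsBaseChangeVia` ∕ ★ `AbelianSchemeOver.IsBaseChangeVia`); `i′ : M′ → X′` a homomorphism with trivial kernel on points; `β : M → X` any
`Spec A`-morphism with `c ≫ β = (i′)^N ≫ G`.  Then `u ≫ β = 1 → u ^ (N · K) = 1` for every point `u : T → M`.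
[cite: Katz1981SerreTate, §1.1 Lemmas 1.1.2–1.1.3 (pp. 138–140) and §1.2 proof of Thm. 1.2.1 (p. 142)] [cite: Messing1972, Ch. I (1.1)–(1.6)] -/
theorem pow_mul_eq_one_of_comp_eq_one_of_lift_pow (hJ : J * J = ⊥) {N K : ℕ} (hK : ∀ a ∈ J, (K : A) * a = 0)
    (w : c ≫ M.hom = M'.hom ≫ Spec.map (CommRingCat.ofHom (Ideal.Quotient.mk J)))
    (hc : IsPullback c M'.hom M.hom (Spec.map (CommRingCat.ofHom (Ideal.Quotient.mk J))))
    (hη : η[M'].left ≫ c = Spec.map (CommRingCat.ofHom (Ideal.Quotient.mk J)) ≫ η[M].left)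
    (hμ : μ[M'].left ≫ c = pullback.map M'.hom M'.hom M.hom M.hom c c (Spec.map (CommRingCat.ofHom (Ideal.Quotient.mk J)))
      w.symm w.symm ≫ μ[M].left)
    (hG : IsPullback G X'.hom X.hom (Spec.map (CommRingCat.ofHom (Ideal.Quotient.mk J))))
    (hηX : η[X'].left ≫ G = Spec.map (CommRingCat.ofHom (Ideal.Quotient.mk J)) ≫ η[X].left)
    (i' : M' ⟶ X') [IsMonHom i'] (hi' : ∀ ⦃T' : Over (Spec (CommRingCat.of (A ⧸ J)))⦄ (y : T' ⟶ M'), y ≫ i' = 1 → y = 1)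
    (β : M ⟶ X) (hβ : c ≫ β.left = (i' ^ N).left ≫ G)
    {T : Over (Spec (CommRingCat.of A))} (u : T ⟶ M) (hu : u ≫ β = 1) : u ^ (N * K) = 1 := by
  -- the reduction `T₀ = T ×_A (A⧸J)` of the test scheme, over `A⧸J` (`T₀'`) and over `A` (through `ρ'`)
  have hρ : IsPullback (pullback.fst T.hom (Spec.map (CommRingCat.ofHom (Ideal.Quotient.mk J))))
      (pullback.snd T.hom (Spec.map (CommRingCat.ofHom (Ideal.Quotient.mk J)))) T.hom
      (Spec.map (CommRingCat.ofHom (Ideal.Quotient.mk J))) := IsPullback.of_hasPullback _ _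
  set ρ := pullback.fst T.hom (Spec.map (CommRingCat.ofHom (Ideal.Quotient.mk J))) with hρdef
  set b := pullback.snd T.hom (Spec.map (CommRingCat.ofHom (Ideal.Quotient.mk J))) with hbdef
  let T₀' : Over (Spec (CommRingCat.of (A ⧸ J))) := Over.mk b
  let ρ' : Over.mk (b ≫ Spec.map (CommRingCat.ofHom (Ideal.Quotient.mk J))) ⟶ T := Over.homMk ρ hρ.w
  have hρ' : ρ'.left = ρ := rfl
  -- the reduced point `u₀ : T₀ → M′` (cartesian `c`)
  have wu : (ρ ≫ u.left) ≫ M.hom = b ≫ Spec.map (CommRingCat.ofHom (Ideal.Quotient.mk J)) := by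
    rw [Category.assoc, Over.w u]; exact hρ.w
  let u₀ : T₀' ⟶ M' := Over.homMk (hc.lift (ρ ≫ u.left) b wu) (hc.lift_snd _ _ wu)
  have hu₀c : u₀.left ≫ c = ρ ≫ u.left := by
    change hc.lift (ρ ≫ u.left) b wu ≫ c = ρ ≫ u.left
    exact hc.lift_fst _ _ wu
  -- Step 1: `(i′)^N (u₀)` lifts `β (ρ' ≫ u) = 1` through the cartesian `G`, hence is the unit
  have h1 : u₀ ≫ i' ^ N = 1 := by
    apply eq_of_left_comp_eq_of_isPullback hG
    have lhs : (u₀ ≫ i' ^ N).left ≫ G = ρ ≫ (u ≫ β).left := by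
      rw [Over.comp_left, Category.assoc, ← hβ, ← Category.assoc, hu₀c, Category.assoc, ← Over.comp_left]
    have rhs : (1 : T₀' ⟶ X').left ≫ G = b ≫ Spec.map (CommRingCat.ofHom (Ideal.Quotient.mk J)) ≫ η[X].left := by
      rw [Hom.one_def, Over.comp_left, Over.toUnit_left, Category.assoc, hηX]
      rfl
    rw [lhs, rhs, hu, Hom.one_def, Over.comp_left, Over.toUnit_left, ← Category.assoc, hρ.w, Category.assoc]
  -- Step 2: `i′ (u₀^N) = 1`, so `u₀^N = 1` (trivial kernel of `i′` on points)
  have h2 : u₀ ^ N = 1 := by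
    apply hi'
    rw [MonObj.pow_comp, ← MonObj.comp_pow, h1]
  -- Step 3: hence `u^N` is the unit on `T₀` (pushing points along `c` respects powers and units)
  have h3 : (ρ' ≫ u) ^ N = 1 := by
    have hpush := pow_left_comp_eq_of_sq w hη hμ u₀ (b := b ≫ Spec.map (CommRingCat.ofHom (Ideal.Quotient.mk J))) rfl
      (ρ' ≫ u) (by rw [Over.comp_left, hρ', hu₀c]) N
    rw [h2] at hpush
    exact eq_one_of_left_eq_one_comp_of_sq hη rfl _ hpush.symm
  have hq : ρ ≫ (u ^ N).left = ρ ≫ (1 : T ⟶ M).left := by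
    have e1 : ρ ≫ (u ^ N).left = ((ρ' ≫ u) ^ N).left := by rw [← MonObj.comp_pow, Over.comp_left, hρ']
    have e2 : ρ ≫ (1 : T ⟶ M).left = (ρ' ≫ (1 : T ⟶ M)).left := by rw [Over.comp_left, hρ']
    rw [e1, e2, h3, MonObj.comp_one]
  -- Step 4: Drinfeld's lemma kills the `T₀`-unit point `u^N` by `K`
  have h4 : (u ^ N) ^ K = 1 := pow_eq_one_of_isPullback hJ hK ρ b hρ (u ^ N) hq
  rw [pow_mul, h4]

/-! ## §2 The Artinian-local Serre–Tate form: `N = K = p ∈ 𝔪_A`, `𝔪_A · J = 0` -/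

omit [IsLocalRing A] in
/-- In a local ring a nilpotent natural number `p` kills every ideal killed by the maximal ideal: `𝔪 · J = 0 → p · J = 0`.
[cite: Katz1981SerreTate, §1.1 (conventions: `N` nilpotent in `R`)] -/
theorem natCast_mul_eq_zero_of_isNilpotent_of_maximalIdeal_mul_eq_bot [IsLocalRing A] {p : ℕ} (hp : IsNilpotent (p : A))
    (hmJ : maximalIdeal A * J = ⊥) : ∀ a ∈ J, (p : A) * a = 0 := by
  intro a ha
  have hpm : (p : A) ∈ maximalIdeal A := by
    rw [IsLocalRing.mem_maximalIdeal, mem_nonunits_iff]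
    intro hunit
    obtain ⟨k, hk⟩ := hp
    exact not_isUnit_zero (hk ▸ hunit.pow k)
  have : (p : A) * a ∈ maximalIdeal A * J := Ideal.mul_mem_mul hpm ha
  rw [hmJ] at this
  exact (Submodule.mem_bot A).mp this

/-- **Serre–Tate form** of `pow_mul_eq_one_of_comp_eq_one_of_lift_pow`: `A` local, `J ≠ ⊤`, `𝔪_A · J = 0`, `(p : A)` nilpotent (so `J² = 0`
and `p · J = 0`); `c : M′ → M`, `G : X′ → X` base-change squares of group schemes over `Spec (A⧸J) ↪ Spec A`; `i′ : M′ → X′` a homomorphism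
with trivial kernel on points; `β : M → X` with `c ≫ β = (i′)^p ≫ G`.  Then `u ≫ β = 1 → u ^ (p ^ 2) = 1`: in the σ2 road of the Serre–Tate
lifting (`M′ = B₀[pⁿ]`, `M = B[pⁿ]`, `X′ = X₀`, `X = Y`, `i′ = i₀ n`, `β = β n`) the kernel of `β n` lies in `B[p²]`, uniformly in `n`, with NO
formal-smoothness input. [cite: Katz1981SerreTate, §1.1 Lemmas 1.1.2–1.1.3 (pp. 138–140) and §1.2 proof of Thm. 1.2.1 (p. 142)]
[cite: Tate1967, §2 (2.1) and (2.4)] -/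
theorem pow_sq_eq_one_of_comp_eq_one_of_lift_pow {p : ℕ} (hp : IsNilpotent (p : A)) (hJ : J ≠ ⊤)
    (hmJ : maximalIdeal A * J = ⊥)
    (w : c ≫ M.hom = M'.hom ≫ Spec.map (CommRingCat.ofHom (Ideal.Quotient.mk J)))
    (hc : IsPullback c M'.hom M.hom (Spec.map (CommRingCat.ofHom (Ideal.Quotient.mk J))))
    (hη : η[M'].left ≫ c = Spec.map (CommRingCat.ofHom (Ideal.Quotient.mk J)) ≫ η[M].left)
    (hμ : μ[M'].left ≫ c = pullback.map M'.hom M'.hom M.hom M.hom c c (Spec.map (CommRingCat.ofHom (Ideal.Quotient.mk J)))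
      w.symm w.symm ≫ μ[M].left)
    (hG : IsPullback G X'.hom X.hom (Spec.map (CommRingCat.ofHom (Ideal.Quotient.mk J))))
    (hηX : η[X'].left ≫ G = Spec.map (CommRingCat.ofHom (Ideal.Quotient.mk J)) ≫ η[X].left)
    (i' : M' ⟶ X') [IsMonHom i'] (hi' : ∀ ⦃T' : Over (Spec (CommRingCat.of (A ⧸ J)))⦄ (y : T' ⟶ M'), y ≫ i' = 1 → y = 1)
    (β : M ⟶ X) (hβ : c ≫ β.left = (i' ^ p).left ≫ G)
    {T : Over (Spec (CommRingCat.of A))} (u : T ⟶ M) (hu : u ≫ β = 1) : u ^ (p ^ 2) = 1 := by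
  have hJJ : J * J = ⊥ := le_bot_iff.mp (hmJ ▸ Ideal.mul_mono_left (IsLocalRing.le_maximalIdeal hJ))
  rw [pow_two]
  exact pow_mul_eq_one_of_comp_eq_one_of_lift_pow hJJ (natCast_mul_eq_zero_of_isNilpotent_of_maximalIdeal_mul_eq_bot hp hmJ)
    w hc hη hμ hG hηX i' hi' β hβ u hu

/-! ## §3 The currency of the σ2 sub-line: Barsotti–Tate layers and abelian schemes -/

omit [IsLocalRing A] [GrpObj M] in
/-- **A kernel embedding has trivial kernel on points**: if `i : K → X` is a homomorphism sitting in a cartesian square against an endomorphism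
`φ` of `X` and the unit section (`K = φ⁻¹(e)`, e.g. `K = X[p^n]`, the clause of ★ `BTGroup.IsOfAbelianScheme`), then `y ≫ i = 1 → y = 1`.
[cite: Tate1967, §2 (2.1)] -/
theorem eq_one_of_comp_eq_one_of_isPullback_unit {S : Scheme.{u}} {K X : Over S} [GrpObj K] [GrpObj X] (i : K ⟶ X) [IsMonHom i]
    {φ : X ⟶ X} (hP : IsPullback i (toUnit K) φ η[X]) {T : Over S} (y : T ⟶ K) (hy : y ≫ i = 1) : y = 1 := by
  apply hP.hom_ext
  · rw [hy, Hom.one_def, Hom.one_def, Category.assoc, IsMonHom.one_hom]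
  · exact toUnit_unique _ _

end Literature.AlgebraicGeometry.GroupSchemes.ReductionKernel

namespace Literature.AlgebraicGeometry.GroupSchemes.BTGroup

open Literature.AlgebraicGeometry.AbelianSchemes

/-- **Messing-free stabilisation in the σ2 road of the Serre–Tate lifting** ([Katz1981SerreTate] §1.2, proof of Thm. 1.2.1, with §1.1 Lemmas
1.1.2–1.1.3): `A` local, `(p : A)` nilpotent, `J ≠ ⊤`, `𝔪_A · J = 0`; `X₀ ∕ Spec (A⧸J)` an abelian scheme with kernel embeddings
`i₀ n : B₀[pⁿ] ↪ X₀` (homomorphisms, cartesian against `[pⁿ]` — the first two clauses of the torsion-tower predicate); `B ∕ Spec A` a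
Barsotti–Tate group with a base change `c : B₀ → B` (★ `IsBaseChangeVia`); `Y ∕ Spec A` an abelian scheme with a base change `GY : X₀ → Y`;
`β n : B[pⁿ] → Y` morphisms with `c n ≫ β n = (i₀ n)^p ≫ GY` (lifts of `p · i₀ n`, the output of the σ2 stub E1).  THEN for every `n` and every
point `u : T → B[pⁿ]`: `u ≫ β n = 1 → u ^ (p²) = 1` — the kernel of `β n` lies in `B[p²]`, uniformly in `n` (★
`ReductionKernel.pow_sq_eq_one_of_comp_eq_one_of_lift_pow`).  No formal smoothness of `B` is used.
[cite: Katz1981SerreTate, §1.2 proof of Thm. 1.2.1 (p. 142) and §1.1 Lemmas 1.1.2–1.1.3 (pp. 138–140)] [cite: Tate1967, §2 (2.1) and (2.4)]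
[cite: Messing1972, Ch. I (1.1)–(1.6)] -/
theorem pow_sq_eq_one_of_comp_betaLift_eq_one {A : Type u} [CommRing A] [IsLocalRing A] {p : ℕ} (hp : IsNilpotent (p : A))
    {J : Ideal A} (hJ : J ≠ ⊤) (hmJ : IsLocalRing.maximalIdeal A * J = ⊥) {h : ℕ}
    (X₀ : AbelianSchemeOver (Spec (.of (A ⧸ J)))) (B₀ : BTGroup (Spec (.of (A ⧸ J))) p h) (i₀ : ∀ n, B₀.G n ⟶ X₀.X)
    (hi₀m : ∀ n, letI := B₀.grpObj n; IsMonHom (i₀ n))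
    (hi₀P : ∀ n, IsPullback (i₀ n) (toUnit (B₀.G n)) (((𝟙 X₀.X : X₀.X ⟶ X₀.X) ^ (p ^ n) : X₀.X ⟶ X₀.X)) η[X₀.X])
    (B : BTGroup (Spec (.of A)) p h) (c : ∀ n, (B₀.G n).left ⟶ (B.G n).left)
    (hc : B₀.IsBaseChangeVia B (Spec.map (CommRingCat.ofHom (Ideal.Quotient.mk J))) c)
    (Y : AbelianSchemeOver (Spec (.of A))) (GY : X₀.X.left ⟶ Y.X.left)
    (hGY : X₀.IsBaseChangeVia Y (Spec.map (CommRingCat.ofHom (Ideal.Quotient.mk J))) GY)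
    (β : ∀ n, B.G n ⟶ Y.X) (hβ : ∀ n, c n ≫ (β n).left = ((i₀ n) ^ p).left ≫ GY)
    (n : ℕ) {T : Over (Spec (.of A))} (u : T ⟶ B.G n) (hu : u ≫ β n = 1) :
    letI := B.grpObj n; u ^ (p ^ 2) = 1 := by
  letI : ∀ n, GrpObj (B.G n) := B.grpObj
  letI : ∀ n, GrpObj (B₀.G n) := B₀.grpObj
  haveI : ∀ n, IsMonHom (i₀ n) := hi₀m
  obtain ⟨w, hP, hη, hμ⟩ := hc.1 n
  exact ReductionKernel.pow_sq_eq_one_of_comp_eq_one_of_lift_pow hp hJ hmJ w hP hη hμ hGY.snd.1 hGY.snd.2.1 (i₀ n)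
    (fun T' y hy => ReductionKernel.eq_one_of_comp_eq_one_of_isPullback_unit (i₀ n) (hi₀P n) y hy) (β n) (hβ n) u hu

end Literature.AlgebraicGeometry.GroupSchemes.BTGroup

end
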